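import Mathlib.Analysis.InnerProductSpace.PiL2
import Mathlib.LinearAlgebra.Trace
import Mathlib.LinearAlgebra.SesquilinearForm.Basic
import HarnessLib

/-!
# Positive definite Hermitian forms on finite-dimensional complex spaces: orthonormal bases, coordinates, Parseval,
# traces, and the complex Euclidean model

Topic `Literature/LinearAlgebra` (namespace `Literature.LinearAlgebra`); Mathlib-only; THEOREMS ONLY — no definition,
no instance, no notation, no named fact.  Complex companion of ★
`Literature.Analysis.InnerProduct.exists_linearEquiv_euclideanSpace_inner_eq` (`Literature/Analysis/InnerProduct/EuclideanModel.lean`,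
which treats real SYMMETRIC BILINEAR forms only).

SETTING.  `W` is a complex vector space (only `AddCommGroup W`, `Module ℂ W` are assumed — whatever topology or norm the
type may otherwise carry is irrelevant, and NO inner-product instance is put on it) and `B : W →ₗ⋆[ℂ] W →ₗ[ℂ] ℂ` is a
sesquilinear form, conjugate-linear in the FIRST variable (Mathlib's inner-product convention; this is the currency of ★
`Representation.IsUnitarizable` = `∃ B, B.IsSymm ∧ (∀ v, v ≠ 0 → 0 < (B v v).re) ∧ invariance`).  A family or basis `b`
is called `B`-ORTHONORMAL when `B (b i) (b j) = if i = j then 1 else 0`.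

RESULTS.
* §1 (pure algebra — ANY sesquilinear `B`, any finite index type, no symmetry or positivity needed): for a
  `B`-orthonormal BASIS `b` of `W`: `repr_eq_apply_of_orthonormal` (coordinates are `B`-products, `b.repr w i = B (b i) w`),
  `sum_apply_smul_eq_of_orthonormal` (`∑ i, B (b i) w • b i = w`), `apply_eq_sum_of_orthonormal` (Parseval,
  `B v w = ∑ i, conj (B (b i) v) * B (b i) w`), `apply_self_eq_sum_normSq_of_orthonormal`,
  `trace_eq_sum_apply_of_orthonormal` (`LinearMap.trace ℂ W T = ∑ i, B (b i) (T (b i))` for EVERY `T : W →ₗ[ℂ] W`);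
  for a `B`-orthonormal FAMILY: `linearIndependent_of_orthonormal`, `exists_basis_of_orthonormal_of_card_eq_finrank`.
* §2 (existence — `B` Hermitian (`B.IsSymm`) and positive definite, `W` finite-dimensional): the complex EUCLIDEAN MODEL
  `exists_complexLinearEquiv_euclideanSpace_inner_eq` (`∃ e : W ≃ₗ[ℂ] EuclideanSpace ℂ (Fin (finrank ℂ W)), ⟪e v, e w⟫_ℂ = B v w`),
  `exists_basis_orthonormal` (`∃ b : Basis (Fin (finrank ℂ W)) ℂ W`, `B`-orthonormal) and the packaged
  `exists_basis_orthonormal_trace_eq`.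
* §3 (SUBSPACE dress — the shape met by consumers: `B` on an ARBITRARY complex space `V`, Hermitian, positive definite on
  a finite-dimensional `W : Submodule ℂ V` only, e.g. the `K`-fixed vectors of an admissible representation; all
  identities in `V`-letters through the coercion `W → V`): `exists_basis_orthonormal_submodule`,
  `sum_apply_smul_eq_of_mem`, `apply_eq_sum_of_mem`, `trace_eq_sum_apply_submodule` (any `T : W →ₗ[ℂ] W`),
  `trace_restrict_eq_sum_apply` (`LinearMap.trace ℂ W (T.restrict hT) = ∑ i, B (b i) (T (b i))` for `T : V →ₗ[ℂ] V`
  preserving `W`), and the packaged `exists_basis_orthonormal_submodule_trace_restrict_eq`.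

WHY (consumer-in-waiting).  The step «trace of `π(φ)` on the finite-dimensional `V^{K′}` through an invariant positive
definite Hermitian form» of the Harish-Chandra trace identity for supercuspidal representations (cell `hodgecm-mathlib`,
census HC-SC §2, E2-2 (T2)): `Tr π(φ) = Σ_i B(e_i, π(φ) e_i)` on a `B`-orthonormal basis `(e_i)` of `V^{K′}`, and the
expansion `π(x) v = Σ_i B(e_i, π(x) v) e_i` of a `K′`-fixed vector — supplied here by §3 with no instance on `V`.

NEAREST PRIOR ART (searched; cited, not restated).  Mathlib: `stdOrthonormalBasis`, `OrthonormalBasis.repr_apply_apply`,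
`OrthonormalBasis.sum_repr'`, `LinearMap.trace_eq_sum_inner` — all for a REGISTERED `InnerProductSpace` instance (here
`W` carries none; §2 builds the structure as a local term from `B` exactly as the real ★ file does, and §1∕§3 never
mention inner products).  Tree: ★ `exists_orthonormal_family_of_definite`
(`Literature/AlgebraicGeometry/Motives/WeilTypePeriodDomainHomogeneous.lean`: a `±1`-orthonormal FAMILY inside a definite
subspace of a FINITE-DIMENSIONAL ambient space, via the spectral theorem — no basis of the subspace, no coordinates, no
trace), ★ `IsPosDefHerm.core` (`Literature/NumberTheory/Automorphic/InfUnitaryHilbertCompletion.lean`: the pre-Hilbert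
structure of `(V, B)` as a term, aimed at Hilbert completions — no finite-dimensional statements).

References (one `[cite:]` token per line — ED. 2 joins the line-broken header token of ED. 1, lit1 (4799), and corrects the
trace locator «§0.4» ↦ «§0.2.5»; no declaration changed).
[cite: HornJohnson2013, §0.6.4–0.6.5 (Gram–Schmidt orthonormalisation; orthonormal bases, coordinates and Parseval)]
[cite: HornJohnson2013, Thm 7.2.7 and Cor. 7.2.8 (a Hermitian matrix is positive definite iff it is *congruent to the identity)]
[cite: HornJohnson2013, §0.2.5 (the trace)]
-/

noncomputable section

open _root_.Module

open scoped _root_.InnerProductSpace _root_.BigOperators _root_.ComplexConjugate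

namespace Literature.LinearAlgebra

/-! ## §1 Algebra of a `B`-orthonormal basis (any sesquilinear `B`) -/

section Orthonormal

variable {W : Type*} [AddCommGroup W] [Module ℂ W]
variable {ι : Type*} [Fintype ι] [DecidableEq ι]

/-- **A `B`-orthonormal family is linearly independent** (apply `B (e i)` to a vanishing linear combination).
[cite: HornJohnson2013, §0.6.4–0.6.5] -/
theorem linearIndependent_of_orthonormal (B : W →ₗ⋆[ℂ] W →ₗ[ℂ] ℂ) (e : ι → W)
    (he : ∀ i j, B (e i) (e j) = if i = j then 1 else 0) : LinearIndependent ℂ e := by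
  rw [Fintype.linearIndependent_iff]
  intro g hg i
  have h := congr_arg (B (e i)) hg
  simp only [map_sum, map_smul, smul_eq_mul, he, mul_ite, mul_one, mul_zero, map_zero] at h
  simpa [Finset.sum_ite_eq] using h

/-- **A `B`-orthonormal family of size `finrank ℂ W` is a basis** (linear independence + cardinality).
[cite: HornJohnson2013, §0.6.4–0.6.5] -/
theorem exists_basis_of_orthonormal_of_card_eq_finrank [FiniteDimensional ℂ W] (B : W →ₗ⋆[ℂ] W →ₗ[ℂ] ℂ) (e : ι → W)
    (he : ∀ i j, B (e i) (e j) = if i = j then 1 else 0) (hcard : Fintype.card ι = finrank ℂ W) :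
    ∃ b : Basis ι ℂ W, ⇑b = e := by
  rcases isEmpty_or_nonempty ι with hι | hι
  · have h0 : finrank ℂ W = 0 := by rw [← hcard, Fintype.card_eq_zero]
    haveI : Subsingleton W := Module.finrank_zero_iff.mp h0
    exact ⟨Basis.empty W, funext fun i => (IsEmpty.false i).elim⟩
  · exact ⟨basisOfLinearIndependentOfCardEqFinrank (linearIndependent_of_orthonormal B e he) hcard,
      coe_basisOfLinearIndependentOfCardEqFinrank _ _⟩

variable (B : W →ₗ⋆[ℂ] W →ₗ[ℂ] ℂ) (b : Basis ι ℂ W) (hb : ∀ i j, B (b i) (b j) = if i = j then 1 else 0)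
include hb

/-- **Coordinates in a `B`-orthonormal basis are `B`-products**: `b.repr w i = B (b i) w`.
[cite: HornJohnson2013, §0.6.4–0.6.5] -/
theorem repr_eq_apply_of_orthonormal (w : W) (i : ι) : b.repr w i = B (b i) w := by
  conv_rhs => rw [← b.sum_repr w]
  simp only [map_sum, map_smul, smul_eq_mul, hb, mul_ite, mul_one, mul_zero]
  simp [Finset.sum_ite_eq]

/-- **Expansion in a `B`-orthonormal basis**: `∑ i, B (b i) w • b i = w`.
[cite: HornJohnson2013, §0.6.4–0.6.5] -/
theorem sum_apply_smul_eq_of_orthonormal (w : W) : ∑ i, B (b i) w • b i = w := by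
  conv_rhs => rw [← b.sum_repr w]
  simp only [repr_eq_apply_of_orthonormal B b hb]

/-- **Parseval's identity for a `B`-orthonormal basis**: `B v w = ∑ i, conj (B (b i) v) * B (b i) w` (for ANY
sesquilinear `B` admitting the orthonormal basis `b`). [cite: HornJohnson2013, §0.6.4–0.6.5] -/
theorem apply_eq_sum_of_orthonormal (v w : W) : B v w = ∑ i, conj (B (b i) v) * B (b i) w := by
  conv_lhs => rw [← sum_apply_smul_eq_of_orthonormal B b hb v]
  simp only [map_sum, LinearMap.map_smulₛₗ, LinearMap.sum_apply, LinearMap.smul_apply, smul_eq_mul,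
    starRingEnd_apply]

/-- **`B v v` is the sum of the squared moduli of the coordinates**: `B v v = ∑ i, |B (b i) v|²` (as a complex number).
[cite: HornJohnson2013, §0.6.4–0.6.5] -/
theorem apply_self_eq_sum_normSq_of_orthonormal (v : W) : B v v = ∑ i, (Complex.normSq (B (b i) v) : ℂ) := by
  rw [apply_eq_sum_of_orthonormal B b hb v v]
  refine Finset.sum_congr rfl fun i _ => ?_
  rw [Complex.normSq_eq_conj_mul_self]

/-- **Trace in a `B`-orthonormal basis**: for every linear `T : W → W`, `tr T = ∑ i, B (b i) (T (b i))` (the diagonal of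
the matrix of `T` in the basis `b` consists of `B`-products by `repr_eq_apply_of_orthonormal`).
[cite: HornJohnson2013, §0.2.5 and §0.6.4–0.6.5] -/
theorem trace_eq_sum_apply_of_orthonormal (T : W →ₗ[ℂ] W) : LinearMap.trace ℂ W T = ∑ i, B (b i) (T (b i)) := by
  rw [LinearMap.trace_eq_matrix_trace ℂ b T, Matrix.trace]
  refine Finset.sum_congr rfl fun i _ => ?_
  rw [Matrix.diag_apply, LinearMap.toMatrix_apply, repr_eq_apply_of_orthonormal B b hb]

end Orthonormal

/-! ## §2 Existence: the complex Euclidean model and `B`-orthonormal bases -/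

section Model

variable {W : Type*} [AddCommGroup W] [Module ℂ W] [FiniteDimensional ℂ W]

/-- **A positive definite Hermitian form is the standard Hermitian inner product in suitable linear coordinates.**
`W` a finite-dimensional complex vector space, `B : W →ₗ⋆[ℂ] W →ₗ[ℂ] ℂ` Hermitian (`B.IsSymm`: `conj (B x y) = B y x`)
with `re (B w w) > 0` for `w ≠ 0`.  Then there is a linear isomorphism `e : W ≃ₗ[ℂ] EuclideanSpace ℂ (Fin (finrank ℂ W))`
with `⟪e v, e w⟫_ℂ = B v w` for all `v, w` (the coordinates in a `B`-orthonormal basis).  Complex twin of ★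
`Literature.Analysis.InnerProduct.exists_linearEquiv_euclideanSpace_inner_eq`.
[cite: HornJohnson2013, Thm 7.2.7 and Cor. 7.2.8 (positive definite ⇔ *congruent to the identity) with §0.6.4–0.6.5 (Gram–Schmidt)] -/
theorem exists_complexLinearEquiv_euclideanSpace_inner_eq (B : W →ₗ⋆[ℂ] W →ₗ[ℂ] ℂ) (hBsymm : B.IsSymm)
    (hBpos : ∀ w : W, w ≠ 0 → 0 < (B w w).re) :
    ∃ e : W ≃ₗ[ℂ] EuclideanSpace ℂ (Fin (finrank ℂ W)), ∀ v w, ⟪e v, e w⟫_ℂ = B v w := by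
  classical
  have hnn : ∀ v : W, 0 ≤ (B v v).re := fun v => by
    by_cases hv : v = 0
    · simp only [hv, map_zero, Complex.zero_re, le_refl]
    · exact (hBpos v hv).le
  let cr : InnerProductSpace.Core ℂ W :=
    { inner := fun v w => B v w
      conj_inner_symm := fun v w => hBsymm.eq w v
      re_inner_nonneg := fun v => by simpa using hnn v
      add_left := fun u v w => by simp only [map_add, LinearMap.add_apply]
      smul_left := fun u v r => by simp only [LinearMap.map_smulₛₗ, LinearMap.smul_apply, smul_eq_mul]
      definite := fun v hv => by
        by_contra h
        have h' := hBpos v h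
        have hv' : B v v = 0 := hv
        rw [hv', Complex.zero_re] at h'
        exact lt_irrefl _ h' }
  letI : NormedAddCommGroup W := cr.toNormedAddCommGroup
  letI : InnerProductSpace ℂ W := InnerProductSpace.ofCore cr.toCore
  refine ⟨(stdOrthonormalBasis ℂ W).repr.toLinearEquiv, fun v w => ?_⟩
  simp only [LinearIsometryEquiv.coe_toLinearEquiv, LinearIsometryEquiv.inner_map_map]
  rfl

/-- **A positive definite Hermitian form has an orthonormal basis** indexed by `Fin (finrank ℂ W)`:
`B (b i) (b j) = if i = j then 1 else 0` (pull back the standard basis of the Euclidean model).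
[cite: HornJohnson2013, Cor. 7.2.8 with §0.6.4–0.6.5 (Gram–Schmidt)] -/
theorem exists_basis_orthonormal (B : W →ₗ⋆[ℂ] W →ₗ[ℂ] ℂ) (hBsymm : B.IsSymm)
    (hBpos : ∀ w : W, w ≠ 0 → 0 < (B w w).re) :
    ∃ b : Basis (Fin (finrank ℂ W)) ℂ W, ∀ i j, B (b i) (b j) = if i = j then 1 else 0 := by
  classical
  obtain ⟨e, he⟩ := exists_complexLinearEquiv_euclideanSpace_inner_eq B hBsymm hBpos
  refine ⟨(EuclideanSpace.basisFun (Fin (finrank ℂ W)) ℂ).toBasis.map e.symm, fun i j => ?_⟩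
  rw [Basis.map_apply, Basis.map_apply, ← he, LinearEquiv.apply_symm_apply, LinearEquiv.apply_symm_apply,
    OrthonormalBasis.coe_toBasis]
  exact orthonormal_iff_ite.mp (EuclideanSpace.basisFun (Fin (finrank ℂ W)) ℂ).orthonormal i j

/-- **Packaged form for consumers**: a `B`-orthonormal basis `b` of `W` such that SIMULTANEOUSLY coordinates are
`B`-products, every vector expands as `∑ i, B (b i) w • b i`, and every endomorphism has trace `∑ i, B (b i) (T (b i))`.
[cite: HornJohnson2013, Cor. 7.2.8, §0.6.4–0.6.5, §0.2.5] -/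
theorem exists_basis_orthonormal_trace_eq (B : W →ₗ⋆[ℂ] W →ₗ[ℂ] ℂ) (hBsymm : B.IsSymm)
    (hBpos : ∀ w : W, w ≠ 0 → 0 < (B w w).re) :
    ∃ b : Basis (Fin (finrank ℂ W)) ℂ W, (∀ i j, B (b i) (b j) = if i = j then 1 else 0) ∧
      (∀ (w : W) (i : Fin (finrank ℂ W)), b.repr w i = B (b i) w) ∧ (∀ w : W, ∑ i, B (b i) w • b i = w) ∧
      ∀ T : W →ₗ[ℂ] W, LinearMap.trace ℂ W T = ∑ i, B (b i) (T (b i)) := by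
  classical
  obtain ⟨b, hb⟩ := exists_basis_orthonormal B hBsymm hBpos
  exact ⟨b, hb, repr_eq_apply_of_orthonormal B b hb, sum_apply_smul_eq_of_orthonormal B b hb,
    trace_eq_sum_apply_of_orthonormal B b hb⟩

end Model

/-! ## §3 Subspace dress: `B` on an arbitrary `V`, positive definite on a finite-dimensional submodule `W` -/

section Submodule

variable {V : Type*} [AddCommGroup V] [Module ℂ V]
variable {ι : Type*} [Fintype ι] [DecidableEq ι]

omit [Fintype ι] in
/-- Orthonormality of a family in a submodule `W` read for the restricted form `B.domRestrict₁₂ W W`.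
[cite: HornJohnson2013, §0.6.4–0.6.5] -/
theorem orthonormal_domRestrict₁₂_iff (B : V →ₗ⋆[ℂ] V →ₗ[ℂ] ℂ) (W : Submodule ℂ V) (e : ι → W) :
    (∀ i j, B.domRestrict₁₂ W W (e i) (e j) = if i = j then 1 else 0) ↔
      ∀ i j, B (e i) (e j) = if i = j then 1 else 0 := by
  simp only [LinearMap.domRestrict₁₂_apply]

/-- **Orthonormal basis of a definite finite-dimensional subspace.**  `B` a Hermitian sesquilinear form on ANY complex
vector space `V` (no finiteness, no topology), positive definite on a finite-dimensional submodule `W`; then `W` has a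
basis `b` with `B (b i) (b j) = if i = j then 1 else 0` (in `V`-letters).
[cite: HornJohnson2013, Cor. 7.2.8 with §0.6.4–0.6.5 (Gram–Schmidt)] -/
theorem exists_basis_orthonormal_submodule (B : V →ₗ⋆[ℂ] V →ₗ[ℂ] ℂ) (hBsymm : B.IsSymm) (W : Submodule ℂ V)
    [FiniteDimensional ℂ W] (hBpos : ∀ w ∈ W, w ≠ 0 → 0 < (B w w).re) :
    ∃ b : Basis (Fin (finrank ℂ W)) ℂ W, ∀ i j, B (b i) (b j) = if i = j then 1 else 0 := by
  have hsymm' : (B.domRestrict₁₂ W W).IsSymm :=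
    ⟨fun x y => by simpa only [LinearMap.domRestrict₁₂_apply] using hBsymm.eq (x : V) (y : V)⟩
  have hpos' : ∀ w : W, w ≠ 0 → 0 < (B.domRestrict₁₂ W W w w).re := fun w hw => by
    rw [LinearMap.domRestrict₁₂_apply]
    exact hBpos w w.2 fun h => hw (Subtype.ext h)
  obtain ⟨b, hb⟩ := exists_basis_orthonormal (B.domRestrict₁₂ W W) hsymm' hpos'
  exact ⟨b, (orthonormal_domRestrict₁₂_iff B W b).mp hb⟩

variable (B : V →ₗ⋆[ℂ] V →ₗ[ℂ] ℂ) (W : Submodule ℂ V) (b : Basis ι ℂ W)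
  (hb : ∀ i j, B (b i) (b j) = if i = j then 1 else 0)
include hb

/-- **Coordinates in a `B`-orthonormal basis of a subspace**: `b.repr w i = B (b i) w` for `w ∈ W` (in `V`-letters).
[cite: HornJohnson2013, §0.6.4–0.6.5] -/
theorem repr_eq_apply_of_mem (w : W) (i : ι) : b.repr w i = B (b i) w := by
  rw [repr_eq_apply_of_orthonormal (B.domRestrict₁₂ W W) b ((orthonormal_domRestrict₁₂_iff B W b).mpr hb) w i,
    LinearMap.domRestrict₁₂_apply]

/-- **Expansion of a vector of the subspace in a `B`-orthonormal basis**, in `V`-letters: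
`∑ i, B (b i) w • (b i : V) = w` for `w ∈ W`. [cite: HornJohnson2013, §0.6.4–0.6.5] -/
theorem sum_apply_smul_eq_of_mem (w : V) (hw : w ∈ W) : ∑ i, B (b i) w • (b i : V) = w := by
  have h := sum_apply_smul_eq_of_orthonormal (B.domRestrict₁₂ W W) b
    ((orthonormal_domRestrict₁₂_iff B W b).mpr hb) ⟨w, hw⟩
  have h' := congr_arg (Subtype.val : W → V) h
  simpa only [Submodule.coe_sum, Submodule.coe_smul, LinearMap.domRestrict₁₂_apply] using h'

/-- **Parseval on the subspace**, in `V`-letters: `B v w = ∑ i, conj (B (b i) v) * B (b i) w` for `v, w ∈ W`.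
[cite: HornJohnson2013, §0.6.4–0.6.5] -/
theorem apply_eq_sum_of_mem (v w : V) (hv : v ∈ W) (hw : w ∈ W) :
    B v w = ∑ i, conj (B (b i) v) * B (b i) w := by
  have h := apply_eq_sum_of_orthonormal (B.domRestrict₁₂ W W) b
    ((orthonormal_domRestrict₁₂_iff B W b).mpr hb) ⟨v, hv⟩ ⟨w, hw⟩
  simpa only [LinearMap.domRestrict₁₂_apply] using h

/-- **Trace of an endomorphism of the subspace in a `B`-orthonormal basis**, in `V`-letters: for every linear
`T : W → W` (e.g. the Hecke operator `π(φ)` on the `K`-fixed vectors), `tr T = ∑ i, B (b i) (T (b i))`.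
[cite: HornJohnson2013, §0.2.5 and §0.6.4–0.6.5] -/
theorem trace_eq_sum_apply_submodule (T : W →ₗ[ℂ] W) :
    LinearMap.trace ℂ W T = ∑ i, B (b i) (T (b i)) := by
  rw [trace_eq_sum_apply_of_orthonormal (B.domRestrict₁₂ W W) b ((orthonormal_domRestrict₁₂_iff B W b).mpr hb) T]
  simp only [LinearMap.domRestrict₁₂_apply]

/-- **Trace of the restriction of an ambient operator**: for `T : V →ₗ[ℂ] V` with `T W ⊆ W`,
`tr (T|_W) = ∑ i, B (b i) (T (b i))`. [cite: HornJohnson2013, §0.2.5 and §0.6.4–0.6.5] -/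
theorem trace_restrict_eq_sum_apply (T : V →ₗ[ℂ] V) (hT : ∀ w ∈ W, T w ∈ W) :
    LinearMap.trace ℂ W (T.restrict hT) = ∑ i, B (b i) (T (b i)) := by
  rw [trace_eq_sum_apply_submodule B W b hb (T.restrict hT)]
  simp only [LinearMap.coe_restrict_apply]

omit hb in
/-- **Packaged form for consumers (subspace).**  `B` Hermitian on `V`, positive definite on the finite-dimensional
submodule `W`: there is a basis `b` of `W`, `B`-orthonormal in `V`-letters, in which every `w ∈ W` expands as
`∑ i, B (b i) w • b i` and every ambient operator preserving `W` has restricted trace `∑ i, B (b i) (T (b i))`.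
[cite: HornJohnson2013, Cor. 7.2.8, §0.6.4–0.6.5, §0.2.5] -/
theorem exists_basis_orthonormal_submodule_trace_restrict_eq (hBsymm : B.IsSymm) [FiniteDimensional ℂ W]
    (hBpos : ∀ w ∈ W, w ≠ 0 → 0 < (B w w).re) :
    ∃ b : Basis (Fin (finrank ℂ W)) ℂ W, (∀ i j, B (b i) (b j) = if i = j then 1 else 0) ∧
      (∀ w ∈ W, ∑ i, B (b i) w • (b i : V) = w) ∧
      (∀ T : W →ₗ[ℂ] W, LinearMap.trace ℂ W T = ∑ i, B (b i) (T (b i))) ∧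
      ∀ (T : V →ₗ[ℂ] V) (hT : ∀ w ∈ W, T w ∈ W), LinearMap.trace ℂ W (T.restrict hT) = ∑ i, B (b i) (T (b i)) := by
  classical
  obtain ⟨b, hb⟩ := exists_basis_orthonormal_submodule B hBsymm W hBpos
  exact ⟨b, hb, sum_apply_smul_eq_of_mem B W b hb, trace_eq_sum_apply_submodule B W b hb,
    trace_restrict_eq_sum_apply B W b hb⟩

end Submodule

end Literature.LinearAlgebra

end
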